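import Summits.SmoothPoincare4.SmoothPoincare4.Theorems.EntropyRungChangGurskyYangStubSmoothRoundLimitAux2
import Literature.Geometry.Riemannian.RicciFlowChartMetricBounds
import Literature.Geometry.Riemannian.CurvatureDerivativeNormSq
import HarnessLib

/-!
# The scaled Ricci flow read in a chart, I: two-sided bounds and the Einstein defect
(helper file for stub `helper_scaledChart_data`, layer S4a of `stub_smoothRoundLimit`, line
`margerin-cone-hamilton-rails`, crux `EntropyRung.ChangGurskyYang`, item stmt-SmoothPoincare4-10834)

Along a Ricci flow `g(t)` of Riemannian metrics on `[0, T)` on a manifold with `4`-dimensional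
Euclidean model, with the roundness rates `|(T−t)R − 2| ≤ C (T−t)^δ` and
`(T−t)² (|Ric|² − R²/4) ≤ C (T−t)^{2δ}` on `[t₀, T)` (`δ > 0`), read the flow in the chart at a
point `z` (`chartRep`, the matrix `G_t(y) = g_t(Φ y)(X_v, X_w)` on the frame vectors of the
trivialization) and scale by `h = T − t`. This file proves the ORDER-ZERO chart data of the
scaled metrics `G̃_t = G_t/(T−t)` (Hamilton 1982, §14, Lemma 14.2 and §17, Thm. 17.6; Topping
2006, Lemma 5.3.2 and the dictionary of p. 47):

* `scaledMetric_comparison` / `scaledChartRep_comparison` — the two-sided comparison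
  `e^{−2a} g̃_{t₀}(X,X) ≤ g̃_t(X,X) ≤ e^{2a} g̃_{t₀}(X,X)`, `a = (κ/δ)(T−t₀)^δ`, `κ = (C²+4C)^{1/2}`
  (the logarithmic Grönwall envelope of `scaledMetric_tendsto_diag`);
* `scaledChartRep_twoSided` — on a closed ball `B̄(ẑ, r) ⊆ target`:
  `λ|v|² ≤ G̃_t(y)(v,v)` and `‖G̃_t(y)‖ ≤ Λ` for `t ∈ [t₀, T)` (comparison with the compact slice
  `t = t₀`, Topping's Lemma 5.3.2 with an integrable rate, and polarisation);
* `norm_ricAt_sub_smul_chartRep_le` — the Einstein defect of the scaled metric decays: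
  `‖Ric(G_t)(y) − G_t(y)/(2(T−t))‖ ≤ κ Λ (T−t)^δ` (`|g − 2(T−t)Ric|(X,X) ≤ κ (T−t)^δ g(X,X)`,
  `abs_sub_two_mul_apply_le`, naturality of `Ric` under the inverse chart, polarisation);
* `helper_scaledChart_twoSided` — the registered form of the two-sided bounds.

## References

* R. S. Hamilton, *Three-manifolds with positive Ricci curvature*, J. Differential Geom. 17
  (1982) 255–306, §14, Lemma 14.2; §17, Thm. 17.6. [Hamilton1982]
* P. Topping, *Lectures on the Ricci flow*, LMS Lecture Note Series 325, CUP 2006, Lemma 5.3.2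
  and §5.3, proof of Thm. 5.3.1, p. 47. [Topping2006]
-/

noncomputable section

-- every `Summit.SmoothPoincare4.SmoothPoincare4.…` name repeats the summit = sub-problem segment (D-0017 layout)
set_option linter.dupNamespace false

-- operator spaces of bilinear forms over the model space
set_option maxSynthPendingDepth 3

open Set Function Filter Real Module Metric
open scoped Manifold ContDiff Topology

namespace Summit.SmoothPoincare4.SmoothPoincare4.Theorems.MargerinRails

open Literature.Geometry.Riemannian
open Literature.Geometry.Lorentzian Literature.Geometry.Lorentzian.PseudoRiemannianMetric
open Literature.Geometry.Lorentzian.MetricCoord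

section ChartData

variable {M : Type*} [TopologicalSpace M] [ChartedSpace (EuclideanSpace ℝ (Fin 4)) M]
  [IsManifold (𝓡 4) ∞ M]
  {g : ℝ → PseudoRiemannianMetric (𝓡 4) ∞ (EuclideanSpace ℝ (Fin 4)) (TangentSpace (𝓡 4) : M → Type _)}
  {cov : ℝ → CovariantDerivative (𝓡 4) (EuclideanSpace ℝ (Fin 4)) (TangentSpace (𝓡 4) : M → Type _)}
  {T δ C t₀ : ℝ}

/-! ### The two-sided comparison of the scaled metric with a fixed slice -/

/-- **Hamilton's Lemma 14.2 for the scaled metric, two-sided form**: along a Ricci flow of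
Riemannian metrics on `[0, T)` with the two roundness rates on `[t₀, T)`, for every tangent vector
`X` and `t ∈ [t₀, T)`,
`e^{−2a} g_{t₀}(X,X)/(T−t₀) ≤ g_t(X,X)/(T−t) ≤ e^{2a} g_{t₀}(X,X)/(T−t₀)` with
`a = (κ/δ)(T−t₀)^δ`, `κ = (C² + 4C)^{1/2}` (both slices lie in the logarithmic Grönwall envelope
of the limit, `scaledMetric_tendsto_diag`). [cite: Hamilton1982, §14, Lemma 14.2]
[cite: Hamilton1982, §17, Thm. 17.6] -/
theorem scaledMetric_comparison (hflow : IsRicciFlow g cov (Ico 0 T))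
    (hR : ∀ t ∈ Ico 0 T, (g t).IsRiemannian) (hδ : 0 < δ) (ht₀ : t₀ ∈ Ico 0 T)
    (hrate : ∀ t ∈ Ico t₀ T, ∀ x : M,
      |(T - t) * (g t).scalarCurvatureWith (cov t) x - 2| ≤ C * (T - t) ^ δ ∧
      (T - t) ^ 2 * ((g t).normSq x ((cov t).ricci x) -
        (g t).scalarCurvatureWith (cov t) x ^ 2 / 4) ≤ C * (T - t) ^ (2 * δ))
    (x : M) (X : TangentSpace (𝓡 4) x) {t : ℝ} (ht : t ∈ Ico t₀ T) :
    exp (-(2 * (Real.sqrt (C ^ 2 + 4 * C) / δ * (T - t₀) ^ δ))) *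
        ((g t₀).val x X X / (T - t₀)) ≤ (g t).val x X X / (T - t) ∧
      (g t).val x X X / (T - t) ≤
        exp (2 * (Real.sqrt (C ^ 2 + 4 * C) / δ * (T - t₀) ^ δ)) * ((g t₀).val x X X / (T - t₀)) := by
  have ht₀' : t₀ ∈ Ico t₀ T := ⟨le_rfl, ht₀.2⟩
  by_cases hX : X = 0
  · subst hX
    simp
  obtain ⟨ℓ, -, -, hbd⟩ := scaledMetric_tendsto_diag hflow hR hδ ht₀ hrate x hX
  obtain ⟨h0lo, h0up⟩ := hbd t₀ ht₀'
  obtain ⟨h1lo, h1up⟩ := hbd t ht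
  set K : ℝ := Real.sqrt (C ^ 2 + 4 * C) / δ with hK
  have hK0 : 0 ≤ K := div_nonneg (Real.sqrt_nonneg _) hδ.le
  have hTt : 0 < T - t := sub_pos.2 ht.2
  have hT₀ : 0 < T - t₀ := sub_pos.2 ht₀.2
  -- the envelope widths `A = K (T−t)^δ ≤ A₀ = K (T−t₀)^δ`
  have hAle : K * (T - t) ^ δ ≤ K * (T - t₀) ^ δ :=
    mul_le_mul_of_nonneg_left (rpow_le_rpow hTt.le (by linarith [ht.1]) hδ.le) hK0
  have hψ₀nn : 0 ≤ (g t₀).val x X X / (T - t₀) := (div_pos (hR t₀ ht₀ x X hX) hT₀).le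
  have hℓnn : 0 ≤ ℓ := le_trans (mul_nonneg (exp_pos _).le hψ₀nn) h0lo
  -- `ψ(t)` against `ℓ`
  have hψup : (g t).val x X X / (T - t) ≤ exp (K * (T - t) ^ δ) * ℓ := by
    have hea := mul_le_mul_of_nonneg_left h1lo (exp_pos (K * (T - t) ^ δ)).le
    rwa [← mul_assoc, ← exp_add, add_neg_cancel, exp_zero, one_mul] at hea
  have hψlo : exp (-(K * (T - t) ^ δ)) * ℓ ≤ (g t).val x X X / (T - t) := by
    have hea := mul_le_mul_of_nonneg_left h1up (exp_pos (-(K * (T - t) ^ δ))).le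
    rwa [← mul_assoc, ← exp_add, neg_add_cancel, exp_zero, one_mul] at hea
  constructor
  · -- lower bound
    have h2 : exp (-(K * (T - t₀) ^ δ)) * ℓ ≤ exp (-(K * (T - t) ^ δ)) * ℓ :=
      mul_le_mul_of_nonneg_right (exp_le_exp.2 (neg_le_neg hAle)) hℓnn
    have h3 : exp (-(K * (T - t₀) ^ δ)) * (exp (-(K * (T - t₀) ^ δ)) * ((g t₀).val x X X / (T - t₀)))
        ≤ exp (-(K * (T - t₀) ^ δ)) * ℓ := mul_le_mul_of_nonneg_left h0lo (exp_pos _).le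
    have h4 : exp (-(2 * (K * (T - t₀) ^ δ))) * ((g t₀).val x X X / (T - t₀)) =
        exp (-(K * (T - t₀) ^ δ)) * (exp (-(K * (T - t₀) ^ δ)) * ((g t₀).val x X X / (T - t₀))) := by
      rw [show -(2 * (K * (T - t₀) ^ δ)) = -(K * (T - t₀) ^ δ) + -(K * (T - t₀) ^ δ) by ring, exp_add]
      ring
    exact h4.le.trans (h3.trans (h2.trans hψlo))
  · -- upper bound
    have h2 : exp (K * (T - t) ^ δ) * ℓ ≤ exp (K * (T - t₀) ^ δ) * ℓ :=
      mul_le_mul_of_nonneg_right (exp_le_exp.2 hAle) hℓnn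
    have h3 : exp (K * (T - t₀) ^ δ) * ℓ ≤
        exp (K * (T - t₀) ^ δ) * (exp (K * (T - t₀) ^ δ) * ((g t₀).val x X X / (T - t₀))) :=
      mul_le_mul_of_nonneg_left h0up (exp_pos _).le
    have h4 : exp (K * (T - t₀) ^ δ) * (exp (K * (T - t₀) ^ δ) * ((g t₀).val x X X / (T - t₀))) =
        exp (2 * (K * (T - t₀) ^ δ)) * ((g t₀).val x X X / (T - t₀)) := by
      rw [show 2 * (K * (T - t₀) ^ δ) = K * (T - t₀) ^ δ + K * (T - t₀) ^ δ by ring, exp_add]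
      ring
    exact hψup.trans (h2.trans (h3.trans h4.le))

/-- **The two-sided comparison read in a chart**: for `y` in the chart target at `z` and a model
vector `v`, the scaled diagonal entry `G_t(y)(v,v)/(T−t)` of the chart representative is pinched
between `e^{∓2a} G_{t₀}(y)(v,v)/(T−t₀)` on `[t₀, T)` (`scaledMetric_comparison` on the frame
vector `X_v` at `Φ y`). [cite: Hamilton1982, §14, Lemma 14.2] [cite: Topping2006, Lemma 5.3.2] -/
theorem scaledChartRep_comparison (hflow : IsRicciFlow g cov (Ico 0 T))
    (hR : ∀ t ∈ Ico 0 T, (g t).IsRiemannian) (hδ : 0 < δ) (ht₀ : t₀ ∈ Ico 0 T)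
    (hrate : ∀ t ∈ Ico t₀ T, ∀ x : M,
      |(T - t) * (g t).scalarCurvatureWith (cov t) x - 2| ≤ C * (T - t) ^ δ ∧
      (T - t) ^ 2 * ((g t).normSq x ((cov t).ricci x) -
        (g t).scalarCurvatureWith (cov t) x ^ 2 / 4) ≤ C * (T - t) ^ (2 * δ))
    (z : M) (y v : EuclideanSpace ℝ (Fin 4)) {t : ℝ} (ht : t ∈ Ico t₀ T) :
    exp (-(2 * (Real.sqrt (C ^ 2 + 4 * C) / δ * (T - t₀) ^ δ))) *
        (chartRep (𝓡 4) g z t₀ y v v / (T - t₀)) ≤ chartRep (𝓡 4) g z t y v v / (T - t) ∧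
      chartRep (𝓡 4) g z t y v v / (T - t) ≤
        exp (2 * (Real.sqrt (C ^ 2 + 4 * C) / δ * (T - t₀) ^ δ)) *
          (chartRep (𝓡 4) g z t₀ y v v / (T - t₀)) :=
  scaledMetric_comparison hflow hR hδ ht₀ hrate ((extChartAt (𝓡 4) z).symm y)
    ((trivializationAt (EuclideanSpace ℝ (Fin 4)) (TangentSpace (𝓡 4) : M → Type _) z).symmL ℝ
      ((extChartAt (𝓡 4) z).symm y) v) ht

/-! ### Two-sided bounds of the scaled representative on a closed chart ball -/

/-- **The scaled chart representative is uniformly positive definite and bounded** (Topping 2006,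
Lemma 5.3.2 with the integrable rate of Hamilton 1982, Lemma 14.2): along a Ricci flow of
Riemannian metrics on `[0, T)` with the two roundness rates on `[t₀, T)`, on a closed ball
`B̄(ẑ, r) ⊆ target` of the chart at `z` there are `λ > 0` and `Λ` with
`λ|v|² ≤ G_t(y)(v,v)/(T−t)` and `‖G_t(y)/(T−t)‖ ≤ Λ` for all `y ∈ B̄(ẑ, r)`, `t ∈ [t₀, T)`
(`scaledChartRep_comparison`, uniform positivity and boundedness of the continuous `G_{t₀}` on
the compact ball, and polarisation `norm_le_of_quadratic_le`). [cite: Topping2006, Lemma 5.3.2]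
[cite: Hamilton1982, §14, Lemma 14.2] [cite: Topping2006, §5.3, p. 47] -/
theorem scaledChartRep_twoSided (hflow : IsRicciFlow g cov (Ico 0 T))
    (hR : ∀ t ∈ Ico 0 T, (g t).IsRiemannian) (hδ : 0 < δ) (ht₀ : t₀ ∈ Ico 0 T)
    (hrate : ∀ t ∈ Ico t₀ T, ∀ x : M,
      |(T - t) * (g t).scalarCurvatureWith (cov t) x - 2| ≤ C * (T - t) ^ δ ∧
      (T - t) ^ 2 * ((g t).normSq x ((cov t).ricci x) -
        (g t).scalarCurvatureWith (cov t) x ^ 2 / 4) ≤ C * (T - t) ^ (2 * δ))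
    (z : M) {r : ℝ} (hr : 0 ≤ r)
    (hcl : closedBall (extChartAt (𝓡 4) z z) r ⊆ (extChartAt (𝓡 4) z).target) :
    ∃ lam Λ : ℝ, 0 < lam ∧ ∀ t ∈ Ico t₀ T, ∀ y ∈ closedBall (extChartAt (𝓡 4) z z) r,
      (∀ v : EuclideanSpace ℝ (Fin 4), lam * ‖v‖ ^ 2 ≤ (T - t)⁻¹ * chartRep (𝓡 4) g z t y v v) ∧
      ‖(T - t)⁻¹ • chartRep (𝓡 4) g z t y‖ ≤ Λ := by
  have hT₀ : 0 < T - t₀ := sub_pos.2 ht₀.2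
  -- `G_{t₀}` on the compact ball
  have hG0 : ContinuousOn (chartRep (𝓡 4) g z t₀) (closedBall (extChartAt (𝓡 4) z z) r) := by
    have hsm : ContDiffOn ℝ ∞ (fun q : EuclideanSpace ℝ (Fin 4) × ℝ ↦ chartRep (𝓡 4) g z q.2 q.1)
        ((extChartAt (𝓡 4) z).target ×ˢ Ico 0 T) := contDiffOn_chartRep hflow.smooth z
    have hι : ContinuousOn (fun y : EuclideanSpace ℝ (Fin 4) ↦ ((y, t₀) : EuclideanSpace ℝ (Fin 4) × ℝ))
        (closedBall (extChartAt (𝓡 4) z z) r) :=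
      (continuous_id.prodMk continuous_const).continuousOn
    have hcomp := hsm.continuousOn.comp hι fun y hy ↦ ⟨hcl hy, ht₀⟩
    exact hcomp
  obtain ⟨lam₀, hlam₀, hlam₀le⟩ := exists_pos_le_quadratic_of_isCompact (isCompact_closedBall _ r)
    hG0 (fun y hy v hv ↦ chartRep_pos (hR t₀ ht₀) z ⟨y, hcl hy⟩ v hv)
  obtain ⟨M₀, hM₀⟩ := (isCompact_closedBall _ r).exists_bound_of_continuousOn hG0
  have hM₀nn : 0 ≤ M₀ := (norm_nonneg _).trans (hM₀ _ (mem_closedBall_self hr))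
  set A : ℝ := 2 * (Real.sqrt (C ^ 2 + 4 * C) / δ * (T - t₀) ^ δ) with hA
  refine ⟨exp (-A) * (lam₀ / (T - t₀)), 2 * (exp A * (M₀ / (T - t₀))),
    mul_pos (exp_pos _) (div_pos hlam₀ hT₀), fun t ht y hy ↦ ?_⟩
  have hTt : 0 < T - t := sub_pos.2 ht.2
  have hy' : y ∈ (extChartAt (𝓡 4) z).target := hcl hy
  -- the comparison with the slice `t₀`
  have hcomp : ∀ v : EuclideanSpace ℝ (Fin 4),
      exp (-A) * (lam₀ / (T - t₀)) * ‖v‖ ^ 2 ≤ chartRep (𝓡 4) g z t y v v / (T - t) ∧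
      chartRep (𝓡 4) g z t y v v / (T - t) ≤ exp A * (M₀ / (T - t₀)) * ‖v‖ ^ 2 := by
    intro v
    obtain ⟨hlo, hup⟩ := scaledChartRep_comparison hflow hR hδ ht₀ hrate z y v ht
    have hψ₀lo : lam₀ * ‖v‖ ^ 2 / (T - t₀) ≤ chartRep (𝓡 4) g z t₀ y v v / (T - t₀) :=
      div_le_div_of_nonneg_right (hlam₀le y hy v) hT₀.le
    have hψ₀up : chartRep (𝓡 4) g z t₀ y v v / (T - t₀) ≤ M₀ * ‖v‖ ^ 2 / (T - t₀) := by
      refine div_le_div_of_nonneg_right ?_ hT₀.le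
      have h1 := abs_apply₂_le (chartRep (𝓡 4) g z t₀ y) v v
      have h2 : ‖chartRep (𝓡 4) g z t₀ y‖ * ‖v‖ * ‖v‖ ≤ M₀ * ‖v‖ * ‖v‖ :=
        mul_le_mul_of_nonneg_right (mul_le_mul_of_nonneg_right (hM₀ y hy) (norm_nonneg _))
          (norm_nonneg _)
      calc chartRep (𝓡 4) g z t₀ y v v ≤ M₀ * ‖v‖ * ‖v‖ := (le_abs_self _).trans (h1.trans h2)
        _ = M₀ * ‖v‖ ^ 2 := by ring
    constructor
    · calc exp (-A) * (lam₀ / (T - t₀)) * ‖v‖ ^ 2 = exp (-A) * (lam₀ * ‖v‖ ^ 2 / (T - t₀)) := by ring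
        _ ≤ exp (-A) * (chartRep (𝓡 4) g z t₀ y v v / (T - t₀)) :=
            mul_le_mul_of_nonneg_left hψ₀lo (exp_pos _).le
        _ ≤ chartRep (𝓡 4) g z t y v v / (T - t) := hlo
    · calc chartRep (𝓡 4) g z t y v v / (T - t)
          ≤ exp A * (chartRep (𝓡 4) g z t₀ y v v / (T - t₀)) := hup
        _ ≤ exp A * (M₀ * ‖v‖ ^ 2 / (T - t₀)) := mul_le_mul_of_nonneg_left hψ₀up (exp_pos _).le
        _ = exp A * (M₀ / (T - t₀)) * ‖v‖ ^ 2 := by ring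
  have happ : ∀ v w : EuclideanSpace ℝ (Fin 4), ((T - t)⁻¹ • chartRep (𝓡 4) g z t y) v w =
      (T - t)⁻¹ * chartRep (𝓡 4) g z t y v w := fun v w ↦ by
    simp only [_root_.smul_apply, smul_eq_mul]
  refine ⟨fun v ↦ ?_, ?_⟩
  · rw [← div_eq_inv_mul]
    exact (hcomp v).1
  · have hsymm : ∀ v w, ((T - t)⁻¹ • chartRep (𝓡 4) g z t y) v w =
        ((T - t)⁻¹ • chartRep (𝓡 4) g z t y) w v := fun v w ↦ by
      rw [happ, happ, chartRep_symm z t hy' v w]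
    refine norm_le_of_quadratic_le hsymm (mul_nonneg (exp_pos _).le (div_nonneg hM₀nn hT₀.le))
      fun v ↦ ?_
    rw [happ, ← div_eq_inv_mul]
    have hnn : 0 ≤ chartRep (𝓡 4) g z t y v v / (T - t) :=
      le_trans (mul_nonneg (mul_nonneg (exp_pos _).le (div_nonneg hlam₀.le hT₀.le)) (sq_nonneg _))
        (hcomp v).1
    rw [abs_of_nonneg hnn]
    exact (hcomp v).2

/-! ### The Einstein defect of the scaled metric in the chart -/

/-- **The Einstein defect of the scaled metric decays in the chart** (Hamilton 1982, §17,
Thm. 17.6 read in a chart): along a Ricci flow of Riemannian metrics on `[0, T)` with the two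
roundness rates on `[t₀, T)`, at a point `y` of the chart target at `z` and a time `t ∈ [t₀, T)`
where `‖G_t(y)/(T−t)‖ ≤ Λ`, the form `Ric(G_t)(y) − G_t(y)/(2(T−t))` (the chart expression of
`Ric(g̃) − g̃/2`, `g̃ = g/(T−t)`, by the scale invariance of the Ricci tensor) has operator norm
`≤ (C² + 4C)^{1/2} Λ (T−t)^δ`: on the diagonal
`|G − 2(T−t)Ric(G)|(v,v) = |g − 2(T−t)Ric|(X_v,X_v) ≤ κ (T−t)^δ g(X_v,X_v) ≤ κ Λ (T−t)^{1+δ}|v|²`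
(`abs_sub_two_mul_apply_le`, `IsRicciFlow.ricAt_chartRep_eq_ricci`), then polarisation.
[cite: Hamilton1982, §17, Thm. 17.6] [cite: Topping2006, §5.3, p. 47] -/
theorem norm_ricAt_sub_smul_chartRep_le (hflow : IsRicciFlow g cov (Ico 0 T))
    (hR : ∀ t ∈ Ico 0 T, (g t).IsRiemannian) (ht₀ : t₀ ∈ Ico 0 T)
    (hrate : ∀ t ∈ Ico t₀ T, ∀ x : M,
      |(T - t) * (g t).scalarCurvatureWith (cov t) x - 2| ≤ C * (T - t) ^ δ ∧
      (T - t) ^ 2 * ((g t).normSq x ((cov t).ricci x) -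
        (g t).scalarCurvatureWith (cov t) x ^ 2 / 4) ≤ C * (T - t) ^ (2 * δ))
    (z : M) {y : EuclideanSpace ℝ (Fin 4)} (hy : y ∈ (extChartAt (𝓡 4) z).target) {t : ℝ}
    (ht : t ∈ Ico t₀ T) {Λ : ℝ} (hΛ : ‖(T - t)⁻¹ • chartRep (𝓡 4) g z t y‖ ≤ Λ) :
    ‖ricAt (chartRep (𝓡 4) g z t) y - (2 * (T - t))⁻¹ • chartRep (𝓡 4) g z t y‖ ≤
      Real.sqrt (C ^ 2 + 4 * C) * Λ * (T - t) ^ δ := by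
  have hTt : 0 < T - t := sub_pos.2 ht.2
  have h2ne : (2 * (T - t)) ≠ 0 := mul_ne_zero two_ne_zero hTt.ne'
  have h2pos : 0 < (2 * (T - t))⁻¹ := inv_pos.2 (mul_pos two_pos hTt)
  have hcanc : (2 * (T - t))⁻¹ * (T - t) = 2⁻¹ := by
    rw [mul_inv, mul_assoc, inv_mul_cancel₀ hTt.ne', mul_one]
  have ht' : t ∈ Ico 0 T := ⟨ht₀.1.trans ht.1, ht.2⟩
  have h4 : finrank ℝ (EuclideanSpace ℝ (Fin 4)) = 4 := finrank_euclideanSpace_fin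
  have hΛ0 : 0 ≤ Λ := (norm_nonneg _).trans hΛ
  have hGm : IsMetricOn (chartRep (𝓡 4) g z t) (extChartAt (𝓡 4) z).target := isMetricOn_chartRep g z t
  have happ : ∀ v w : EuclideanSpace ℝ (Fin 4), ((T - t)⁻¹ • chartRep (𝓡 4) g z t y) v w =
      (T - t)⁻¹ * chartRep (𝓡 4) g z t y v w := fun v w ↦ by
    simp only [_root_.smul_apply, smul_eq_mul]
  -- `G_t(y)(u,u) ≤ Λ (T−t) |u|²`
  have hup : ∀ u : EuclideanSpace ℝ (Fin 4), chartRep (𝓡 4) g z t y u u ≤ Λ * (T - t) * ‖u‖ ^ 2 := by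
    intro u
    have h1 := abs_apply₂_le ((T - t)⁻¹ • chartRep (𝓡 4) g z t y) u u
    rw [happ, abs_mul, abs_of_pos (inv_pos.2 hTt)] at h1
    have h3 : ‖(T - t)⁻¹ • chartRep (𝓡 4) g z t y‖ * ‖u‖ * ‖u‖ ≤ Λ * ‖u‖ * ‖u‖ :=
      mul_le_mul_of_nonneg_right (mul_le_mul_of_nonneg_right hΛ (norm_nonneg _)) (norm_nonneg _)
    have h5 : (T - t)⁻¹ * chartRep (𝓡 4) g z t y u u ≤ Λ * ‖u‖ ^ 2 := by
      calc (T - t)⁻¹ * chartRep (𝓡 4) g z t y u u ≤ (T - t)⁻¹ * |chartRep (𝓡 4) g z t y u u| :=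
            mul_le_mul_of_nonneg_left (le_abs_self _) (inv_pos.2 hTt).le
        _ ≤ Λ * ‖u‖ * ‖u‖ := h1.trans h3
        _ = Λ * ‖u‖ ^ 2 := by ring
    rw [inv_mul_le_iff₀ hTt] at h5
    calc chartRep (𝓡 4) g z t y u u ≤ (T - t) * (Λ * ‖u‖ ^ 2) := h5
      _ = Λ * (T - t) * ‖u‖ ^ 2 := by ring
  -- the diagonal bound of the defect
  have hdiag : ∀ u : EuclideanSpace ℝ (Fin 4),
      |(ricAt (chartRep (𝓡 4) g z t) y - (2 * (T - t))⁻¹ • chartRep (𝓡 4) g z t y) u u| ≤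
        Real.sqrt (C ^ 2 + 4 * C) * Λ / 2 * (T - t) ^ δ * ‖u‖ ^ 2 := by
    intro u
    set x : M := (extChartAt (𝓡 4) z).symm y with hx
    set X : TangentSpace (𝓡 4) x :=
      (trivializationAt (EuclideanSpace ℝ (Fin 4)) (TangentSpace (𝓡 4) : M → Type _) z).symmL ℝ x u
      with hX
    have hG : chartRep (𝓡 4) g z t y u u = (g t).val x X X := rfl
    have hRic : ricAt (chartRep (𝓡 4) g z t) y u u = (cov t).ricci x X X :=
      hflow.ricAt_chartRep_eq_ricci ht' z ⟨y, hy⟩ u u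
    obtain ⟨h₁, h₂⟩ := hrate t ht x
    have key := abs_sub_two_mul_apply_le (g t) (hR t ht') h4 x ((cov t).ricci x) (s := T - t) h₁ h₂ X
    have hsqrt : Real.sqrt ((C * (T - t) ^ δ) ^ 2 + 4 * (C * (T - t) ^ (2 * δ))) =
        Real.sqrt (C ^ 2 + 4 * C) * (T - t) ^ δ := by
      have h2δ : (T - t) ^ (2 * δ) = ((T - t) ^ δ) ^ 2 := by
        rw [mul_comm, rpow_mul hTt.le, rpow_two]
      rw [h2δ, show (C * (T - t) ^ δ) ^ 2 + 4 * (C * ((T - t) ^ δ) ^ 2) =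
        (C ^ 2 + 4 * C) * ((T - t) ^ δ) ^ 2 by ring, Real.sqrt_mul' _ (sq_nonneg _),
        Real.sqrt_sq (rpow_nonneg hTt.le δ)]
    rw [hsqrt] at key
    have hval : (ricAt (chartRep (𝓡 4) g z t) y - (2 * (T - t))⁻¹ • chartRep (𝓡 4) g z t y) u u =
        (2 * (T - t))⁻¹ * (2 * (T - t) * (cov t).ricci x X X - (g t).val x X X) := by
      simp only [_root_.sub_apply, _root_.smul_apply, smul_eq_mul]
      rw [hRic, hG, mul_sub (2 * (T - t))⁻¹, ← mul_assoc, inv_mul_cancel₀ h2ne, one_mul]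
    rw [hval, abs_mul, abs_of_pos h2pos, abs_sub_comm]
    have hg0 : 0 ≤ Real.sqrt (C ^ 2 + 4 * C) * (T - t) ^ δ :=
      mul_nonneg (Real.sqrt_nonneg _) (rpow_nonneg hTt.le δ)
    calc (2 * (T - t))⁻¹ * |(g t).val x X X - 2 * (T - t) * (cov t).ricci x X X|
        ≤ (2 * (T - t))⁻¹ * (Real.sqrt (C ^ 2 + 4 * C) * (T - t) ^ δ * (g t).val x X X) :=
          mul_le_mul_of_nonneg_left key h2pos.le
      _ ≤ (2 * (T - t))⁻¹ * (Real.sqrt (C ^ 2 + 4 * C) * (T - t) ^ δ * (Λ * (T - t) * ‖u‖ ^ 2)) :=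
          mul_le_mul_of_nonneg_left (mul_le_mul_of_nonneg_left (hG ▸ hup u) hg0) h2pos.le
      _ = (2 * (T - t))⁻¹ * (T - t) * (Real.sqrt (C ^ 2 + 4 * C) * Λ * (T - t) ^ δ * ‖u‖ ^ 2) := by
          ring
      _ = Real.sqrt (C ^ 2 + 4 * C) * Λ / 2 * (T - t) ^ δ * ‖u‖ ^ 2 := by
          rw [hcanc]
          ring
  -- polarisation
  have hsymm : ∀ v w, (ricAt (chartRep (𝓡 4) g z t) y - (2 * (T - t))⁻¹ • chartRep (𝓡 4) g z t y) v w =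
      (ricAt (chartRep (𝓡 4) g z t) y - (2 * (T - t))⁻¹ • chartRep (𝓡 4) g z t y) w v := by
    intro v w
    simp only [_root_.sub_apply, _root_.smul_apply, smul_eq_mul,
      hGm.ricAt_comm hy v w, chartRep_symm z t hy v w]
  have hc : 0 ≤ Real.sqrt (C ^ 2 + 4 * C) * Λ / 2 * (T - t) ^ δ :=
    mul_nonneg (div_nonneg (mul_nonneg (Real.sqrt_nonneg _) hΛ0) two_pos.le) (rpow_nonneg hTt.le δ)
  calc ‖ricAt (chartRep (𝓡 4) g z t) y - (2 * (T - t))⁻¹ • chartRep (𝓡 4) g z t y‖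
      ≤ 2 * (Real.sqrt (C ^ 2 + 4 * C) * Λ / 2 * (T - t) ^ δ) := norm_le_of_quadratic_le hsymm hc hdiag
    _ = Real.sqrt (C ^ 2 + 4 * C) * Λ * (T - t) ^ δ := by ring

end ChartData

/-! ### The registered helper -/

/-- **HELPER `helper_scaledChart_twoSided` — the two-sided chart bounds of the scaled metric
`g/(T−t)`** (layer S4a(i) of `stub_smoothRoundLimit`; Hamilton 1982, Lemma 14.2 with Topping's
Lemma 5.3.2 read in a chart): along a Ricci flow of Riemannian metrics on `[0, T)` on a closed
4-manifold with the two roundness rates on `[t₀, T)`, on every closed ball `B̄(ẑ, r)` inside the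
chart target at `z` there are `λ > 0` and `Λ` with `λ|v|² ≤ G_t(y)(v,v)/(T−t)` and
`‖G_t(y)/(T−t)‖ ≤ Λ` for `y ∈ B̄(ẑ, r)`, `t ∈ [t₀, T)` (`scaledChartRep_twoSided`).
[cite: Hamilton1982, §14, Lemma 14.2] [cite: Topping2006, Lemma 5.3.2] [cite: Topping2006, §5.3, p. 47] -/
theorem helper_scaledChart_twoSided : ∀ (M : Type) [TopologicalSpace M] [T2Space M] [SecondCountableTopology M] [ChartedSpace (EuclideanSpace ℝ (Fin 4)) M] [IsManifold (𝓡 4) ∞ M] [CompactSpace M] (g : ℝ → PseudoRiemannianMetric (𝓡 4) ∞ (EuclideanSpace ℝ (Fin 4)) (TangentSpace (𝓡 4) : M → Type _)) (cov : ℝ → CovariantDerivative (𝓡 4) (EuclideanSpace ℝ (Fin 4)) (TangentSpace (𝓡 4) : M → Type _)) (T : ℝ), 0 < T → IsRicciFlow g cov (Ico 0 T) → (∀ t ∈ Ico 0 T, (g t).IsRiemannian) → ∀ (δ C t₀ : ℝ), 0 < δ → t₀ ∈ Ico 0 T → (∀ t ∈ Ico t₀ T, ∀ x : M, |(T - t)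 * (g t).scalarCurvatureWith (cov t) x - 2| ≤ C * (T - t) ^ δ ∧ (T - t) ^ 2 * ((g t).normSq x ((cov t).ricci x) - (g t).scalarCurvatureWith (cov t) x ^ 2 / 4) ≤ C * (T - t) ^ (2 * δ)) → ∀ (z : M) (r : ℝ), 0 ≤ r → Metric.closedBall (extChartAt (𝓡 4) z z) r ⊆ (extChartAt (𝓡 4) z).target → ∃ lam Λ : ℝ, 0 < lam ∧ ∀ t ∈ Ico t₀ T, ∀ y ∈ Metric.closedBall (extChartAt (𝓡 4) z z) r, (∀ v : EuclideanSpace ℝ (Fin 4), lam * ‖v‖ ^ 2 ≤ (T - t)⁻¹ * chartRep (𝓡 4) g z t y v v) ∧ ‖(T - t)⁻¹ • chartRep (𝓡 4) g z t y‖ ≤ Λ := by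
  intro M _ _ _ _ _ _ g cov T _ hflow hR δ C t₀ hδ ht₀ hrate z r hr hcl
  exact scaledChartRep_twoSided hflow hR hδ ht₀ hrate z hr hcl

end Summit.SmoothPoincare4.SmoothPoincare4.Theorems.MargerinRails

end
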